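import Mathlib
import Summits.Ventures.PercRepro.TriangleCapCapStructure

/-!
# PercRepro — THE ROW `a = 3` OF THE STABILITY TABLE, THE NON-BIPARTITE HALF: on every cell `(k, 3, r)` with
`k ≥ r + 7` a `K₄⁻`-free graph is a spanning subgraph of some `K(A, Aᶜ)`, `|A| = 3`, or at least `2 (k − 7)`
below the closed form (`2 (k − 6)` at `r = 0`) — the degree argument at second order (p3, gen 43; part 191)

`three_row_second_order`: `K₄⁻`-free, `m + 9 + r = 3k`, `r + 7 ≤ k` ⇒ `(∃ A, |A| = 3 ∧ BipSub D A) ∨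
Σ_v d(v)² + r (k − 1 − r) + 2 (k − 7) + 2·[r = 0] ≤ m k`. The proof is a strong induction on `r` over every
vertex type (as `closed_form_stability_aux`, part 166): the cap `d ≤ k − 3` (part 158); a vertex AT the cap —
part 190 (`three_row_cap`); every degree in `[3, k − 4]` — the convexity `Σ (d − 3)(k − 4 − d) ≥ 0` gives
`3 (k − 6) + r (r − 1)` (`three_row_convex`); a vertex `z` of degree `d ≤ 2` with `r + d ≥ 3` — deleted onto the
cell `(k − 1, 3, r + d − 3)` of the same row, where the induction hypothesis applies: `D − z` is `3`-bipartite
(then `D` is, by `bipSub_lift`, unless `z` has a neighbour on the large side, of degree `≤ 3 ≤ k − 5 − (k − 8)`: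
deficit `2 (k − 8)` plus the `2` of the cap `k − 5`) or `≥ 2 (k − 8) + 2·[r' = 0]` below, and the deletion slack
`(2 − d)(r − 3 + d) + 2d` supplies the missing `2`; `r + d ≤ 2` — `D − z` lies on the ROW `a = 4` at `k − 1`
(cell `r'' = k − 11 + r + d`, impossible for `k ≤ 10 − r − d` by the envelope `4m' ≤ (k − 1)²`), and the closed
form there (part 166 at `a = 4`) with the cap `k − 5` closes every one of the six cases `(r, d)`
(`three_row_cross`). Axioms: standard.
-/

namespace PercRepro

namespace TriangleCap

namespace C047

open Finset

universe u

variable {V : Type*} [Fintype V] [DecidableEq V]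

/-- The convexity term of one vertex: `3 ≤ d ≤ k − 4` ⇒ `d² + 3 (k − 4) ≤ (k − 1) d`. -/
theorem convex_vertex (d k : ℕ) (h3 : 3 ≤ d) (hd : d + 4 ≤ k) : d * d + 3 * (k - 4) ≤ (k - 1) * d := by
  obtain ⟨a, rfl⟩ : ∃ a, d = a + 3 := ⟨d - 3, by omega⟩
  obtain ⟨b, rfl⟩ : ∃ b, k = a + 3 + 4 + b := ⟨k - (a + 3 + 4), by omega⟩
  have e1 : a + 3 + 4 + b - 4 = a + 3 + b := by omega
  have e2 : a + 3 + 4 + b - 1 = a + 6 + b := by omega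
  rw [e1, e2]
  nlinarith [Nat.zero_le (a * b)]

omit [DecidableEq V] in
/-- **THE CONVEXITY CASE:** every degree in `[3, k − 4]` on the cell `m + 9 + r = 3k`, `r + 6 ≤ k` ⇒
`Σ_v d(v)² + r (k − 1 − r) + 2 (k − 6) ≤ m k` (the gap is `3 (k − 6) + r (r − 1)`). -/
theorem three_row_convex (D : SimpleGraph V) [DecidableRel D.Adj] (r : ℕ) (hk : r + 6 ≤ Fintype.card V)
    (hm : D.edgeFinset.card + 9 + r = 3 * Fintype.card V) (hcap : ∀ v, deg D v + 4 ≤ Fintype.card V)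
    (hdeg : ∀ v, 3 ≤ deg D v) :
    ∑ v, deg D v * deg D v + r * (Fintype.card V - 1 - r) + 2 * (Fintype.card V - 6) ≤
      D.edgeFinset.card * Fintype.card V := by
  have hsum : ∑ v, (deg D v * deg D v + 3 * (Fintype.card V - 4)) ≤ ∑ v, (Fintype.card V - 1) * deg D v :=
    sum_le_sum (fun v _ => convex_vertex (deg D v) (Fintype.card V) (hdeg v) (hcap v))
  rw [sum_add_distrib, sum_const, card_univ, smul_eq_mul, ← mul_sum, sum_deg_eq] at hsum
  obtain ⟨k, hk'⟩ : ∃ k, Fintype.card V = k := ⟨_, rfl⟩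
  obtain ⟨m, hm'⟩ : ∃ m, D.edgeFinset.card = m := ⟨_, rfl⟩
  obtain ⟨S, hS⟩ : ∃ S, ∑ v, deg D v * deg D v = S := ⟨_, rfl⟩
  rw [hk', hm'] at hsum hm
  rw [hk'] at hk
  rw [hS] at hsum ⊢
  rw [hk', hm']
  obtain ⟨t, rfl⟩ : ∃ t, k = r + 6 + t := ⟨k - (r + 6), by omega⟩
  obtain rfl : m = 2 * r + 9 + 3 * t := by omega
  have e1 : r + 6 + t - 4 = r + 2 + t := by omega
  have e2 : r + 6 + t - 1 = r + 5 + t := by omega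
  have e3 : r + 6 + t - 1 - r = 5 + t := by omega
  have e4 : r + 6 + t - 6 = r + t := by omega
  rw [e1, e2] at hsum
  rw [e3, e4]
  nlinarith [hsum, Nat.zero_le (r * r)]

/-- The deletion sum with one small neighbour: if every degree is `≤ c + 1` and some neighbour `a₀` of `z` has
`deg (D − z) a₀ ≤ e ≤ c`, then `Σ_{a ∼ z} d_{D−z}(a) + (c − e) ≤ d(z) · c`. -/
theorem sum_del_nbhd_le_of_small (D : SimpleGraph V) [DecidableRel D.Adj] (z : V) (c e : ℕ)
    (hcap : ∀ v, deg D v ≤ c + 1) (a₀ : {v : V // v ≠ z}) (ha₀ : D.Adj a₀.1 z) (he : deg (del D z) a₀ ≤ e)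
    (hec : e ≤ c) :
    ∑ a : {v : V // v ≠ z}, (if D.Adj a.1 z then deg (del D z) a else 0) + (c - e) ≤ deg D z * c := by
  have hsplit : ∑ a : {v : V // v ≠ z}, (if D.Adj a.1 z then deg (del D z) a else 0) =
      (if D.Adj a₀.1 z then deg (del D z) a₀ else 0) +
        ∑ a ∈ univ.erase a₀, (if D.Adj a.1 z then deg (del D z) a else 0) := by
    rw [← add_sum_erase univ _ (mem_univ a₀)]
  have hsplit' : ∑ a : {v : V // v ≠ z}, (if D.Adj a.1 z then c else 0) =
      (if D.Adj a₀.1 z then c else 0) + ∑ a ∈ univ.erase a₀, (if D.Adj a.1 z then c else 0) := by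
    rw [← add_sum_erase univ _ (mem_univ a₀)]
  have hle : ∑ a ∈ univ.erase a₀, (if D.Adj a.1 z then deg (del D z) a else 0) ≤
      ∑ a ∈ univ.erase a₀, (if D.Adj a.1 z then c else 0) := by
    apply sum_le_sum
    intro a _
    by_cases h : D.Adj a.1 z
    · simp only [h, if_true]
      have h1 := deg_del D z a
      simp only [h, if_true] at h1
      have h2 := hcap a.1
      omega
    · simp only [h, if_false]
      exact le_refl 0
  have hconst := sum_del_nbhd_const D z c
  rw [if_pos ha₀] at hsplit hsplit'
  omega

/-- **THE WITHIN-ROW ARITHMETIC, BIPARTITE BRANCH:** `k = r + 7 + s`, `1 ≤ d ≤ 2`, `m' + d = m`,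
`D − z` on the cell `(k − 1, 3, r')` with `r' + 3 = r + d` at the closed form, one neighbour of `z` of degree
`≤ 3` — `S' + r' Q ≤ m' (k − 1)` (`Q = k − 2 − r'`, `Q + d = 8 + s`), `T + (k − 8) ≤ d (k − 5)` ⇒ the gap `2 (k − 7)`. -/
theorem within_arith_bip (r s d m' S' T Q r' : ℕ) (hd1 : 1 ≤ d) (hd2 : d ≤ 2) (hr' : r' + 3 = r + d)
    (hm : m' + d + 9 + r = 3 * (r + 7 + s)) (hQ : Q + d = 8 + s)
    (hS' : S' + r' * Q ≤ m' * (r + 6 + s)) (hT : T + (r + s) ≤ d * (r + 2 + s) + 1) :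
    S' + 2 * T + d + d * d + r * (s + 6) + 2 * (r + s) ≤ (m' + d) * (r + 7 + s) := by
  interval_cases d
  · obtain rfl : r = r' + 2 := by omega
    obtain rfl : Q = 7 + s := by omega
    obtain rfl : m' = 2 * r' + 3 * s + 15 := by omega
    nlinarith [hS', hT]
  · obtain rfl : r = r' + 1 := by omega
    obtain rfl : Q = 6 + s := by omega
    obtain rfl : m' = 2 * r' + 3 * s + 12 := by omega
    nlinarith [hS', hT]

/-- **THE WITHIN-ROW ARITHMETIC, GAP BRANCH:** `k = r + 7 + s`, `d ≤ 2`, `D − z` on the cell `(k − 1, 3, r')`,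
`r' + 3 = r + d`, at least `2 (k − 8) + 2·[r' = 0]` below its closed form, `T ≤ d (k − 5)` ⇒ the gap `2 (k − 7)`
(`k7 + 1 = r + s` is `k − 8`). -/
theorem within_arith_gap (r s d m' S' T Q r' k7 : ℕ) (hd2 : d ≤ 2) (hr' : r' + 3 = r + d)
    (hm : m' + d + 9 + r = 3 * (r + 7 + s)) (hQ : Q + d = 8 + s) (hk7 : k7 + 1 = r + s)
    (hS' : S' + r' * Q + 2 * k7 + (if r' = 0 then 2 else 0) ≤ m' * (r + 6 + s))
    (hT : T ≤ d * (r + 2 + s)) :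
    S' + 2 * T + d + d * d + r * (s + 6) + 2 * (r + s) ≤ (m' + d) * (r + 7 + s) := by
  interval_cases d
  · obtain rfl : r = r' + 3 := by omega
    obtain rfl : Q = 8 + s := by omega
    obtain rfl : m' = 2 * r' + 3 * s + 18 := by omega
    obtain rfl : k7 = r' + 2 + s := by omega
    rcases Nat.eq_zero_or_pos r' with h0 | hpos
    · subst h0
      simp only [if_true] at hS'
      nlinarith [hS', hT]
    · rw [if_neg (by omega)] at hS'
      nlinarith [hS', hT]
  · obtain rfl : r = r' + 2 := by omega
    obtain rfl : Q = 7 + s := by omega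
    obtain rfl : m' = 2 * r' + 3 * s + 15 := by omega
    obtain rfl : k7 = r' + 1 + s := by omega
    have : 0 ≤ (if r' = 0 then 2 else 0) := Nat.zero_le _
    nlinarith [hS', hT, this]
  · obtain rfl : r = r' + 1 := by omega
    obtain rfl : Q = 6 + s := by omega
    obtain rfl : m' = 2 * r' + 3 * s + 12 := by omega
    obtain rfl : k7 = r' + s := by omega
    have : 0 ≤ (if r' = 0 then 2 else 0) := Nat.zero_le _
    nlinarith [hS', hT, this]

/-- **THE CROSS-ROW ARITHMETIC:** `r + d ≤ 2`, `k = k5 + 5 ≥ 11 − r − d`, `D − z` on the cell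
`(k − 1, 4, r'')`, `r'' + 11 = k + r + d`, at the closed form `S' + r'' Q ≤ m' (k − 1)` with `Q + r + d = 9`,
`T ≤ d (k − 5)` ⇒ `S' + 2T + d + d² + r (k − 1 − r) + 2 (k − 7) + I ≤ m k`, `I = 2·[r = 0]`. -/
theorem cross_arith (r d k5 m' S' T Q r'' I : ℕ) (hrd : r + d ≤ 2) (hk : 11 ≤ k5 + 5 + r + d)
    (hm : m' + d + 9 + r = 3 * (k5 + 5)) (hr'' : r'' + 11 = k5 + 5 + r + d) (hQ : Q + r + d = 9)
    (hS' : S' + r'' * Q ≤ m' * (k5 + 4)) (hT : T ≤ d * k5) (hI : I = if r = 0 then 2 else 0) :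
    S' + 2 * T + d + d * d + r * (k5 + 4 - r) + 2 * (k5 - 2) + I ≤ (m' + d) * (k5 + 5) := by
  have hr2 : r ≤ 2 := by omega
  have hd2 : d ≤ 2 := by omega
  interval_cases r <;> interval_cases d <;> norm_num at hI <;> subst hI <;> try omega
  · -- `(0, 0)`: `k ≥ 11`
    obtain ⟨t, rfl⟩ : ∃ t, k5 = t + 6 := ⟨k5 - 6, by omega⟩
    obtain rfl : t = r'' := by omega
    obtain rfl : Q = 9 := by omega
    obtain rfl : m' = 3 * t + 24 := by omega
    have e1 : t + 6 + 4 - 0 = t + 10 := by omega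
    have e2 : t + 6 - 2 = t + 4 := by omega
    nlinarith [hS', hT, e1, e2]
  · -- `(0, 1)`: `k ≥ 10`
    obtain ⟨t, rfl⟩ : ∃ t, k5 = t + 5 := ⟨k5 - 5, by omega⟩
    obtain rfl : t = r'' := by omega
    obtain rfl : Q = 8 := by omega
    obtain rfl : m' = 3 * t + 20 := by omega
    have e1 : t + 5 + 4 - 0 = t + 9 := by omega
    have e2 : t + 5 - 2 = t + 3 := by omega
    nlinarith [hS', hT, e1, e2]
  · -- `(0, 2)`: `k ≥ 9`
    obtain ⟨t, rfl⟩ : ∃ t, k5 = t + 4 := ⟨k5 - 4, by omega⟩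
    obtain rfl : t = r'' := by omega
    obtain rfl : Q = 7 := by omega
    obtain rfl : m' = 3 * t + 16 := by omega
    have e1 : t + 4 + 4 - 0 = t + 8 := by omega
    have e2 : t + 4 - 2 = t + 2 := by omega
    nlinarith [hS', hT, e1, e2]
  · -- `(1, 0)`: `k ≥ 10`
    obtain ⟨t, rfl⟩ : ∃ t, k5 = t + 5 := ⟨k5 - 5, by omega⟩
    obtain rfl : t = r'' := by omega
    obtain rfl : Q = 8 := by omega
    obtain rfl : m' = 3 * t + 20 := by omega
    have e1 : t + 5 + 4 - 1 = t + 8 := by omega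
    have e2 : t + 5 - 2 = t + 3 := by omega
    nlinarith [hS', hT, e1, e2]
  · -- `(1, 1)`: `k ≥ 9`
    obtain ⟨t, rfl⟩ : ∃ t, k5 = t + 4 := ⟨k5 - 4, by omega⟩
    obtain rfl : t = r'' := by omega
    obtain rfl : Q = 7 := by omega
    obtain rfl : m' = 3 * t + 16 := by omega
    have e1 : t + 4 + 4 - 1 = t + 7 := by omega
    have e2 : t + 4 - 2 = t + 2 := by omega
    nlinarith [hS', hT, e1, e2]
  · -- `(2, 0)`: `k ≥ 9`
    obtain ⟨t, rfl⟩ : ∃ t, k5 = t + 4 := ⟨k5 - 4, by omega⟩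
    obtain rfl : t = r'' := by omega
    obtain rfl : Q = 7 := by omega
    obtain rfl : m' = 3 * t + 16 := by omega
    have e1 : t + 4 + 4 - 2 = t + 6 := by omega
    have e2 : t + 4 - 2 = t + 2 := by omega
    nlinarith [hS', hT, e1, e2]

/-- **THE CROSS-ROW CASE:** on the cell `m + 9 + r = 3k`, `r + 7 ≤ k`, every degree `≤ k − 4`, a vertex `z` with
`r + deg z ≤ 2` ⇒ `Σ_v d(v)² + r (k − 1 − r) + 2 (k − 7) + 2·[r = 0] ≤ m k`: `D − z` lies on the row `a = 4`
at `k − 1`, where the closed form and the cap `k − 5` close the six cases. -/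
theorem three_row_cross (D : SimpleGraph V) [DecidableRel D.Adj] (hK : K4mFree D) (r : ℕ)
    (hk : r + 7 ≤ Fintype.card V) (hm : D.edgeFinset.card + 9 + r = 3 * Fintype.card V)
    (hcap : ∀ v, deg D v + 4 ≤ Fintype.card V) (z : V) (hz : r + deg D z ≤ 2) :
    ∑ v, deg D v * deg D v + r * (Fintype.card V - 1 - r) + 2 * (Fintype.card V - 7) +
      (if r = 0 then 2 else 0) ≤ D.edgeFinset.card * Fintype.card V := by
  have hK' := k4mFree_del D hK z
  have hcard' := card_del z
  have hedges' := card_edges_del D z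
  have hsq := sum_deg_sq_del D z
  have hT := sum_del_nbhd_le D z (Fintype.card V - 5) (fun v => by have := hcap v; omega)
  obtain ⟨d, hd⟩ : ∃ d, deg D z = d := ⟨_, rfl⟩
  rw [hd] at hz hedges' hsq hT
  obtain ⟨k5, hk5⟩ : ∃ k5, Fintype.card V = k5 + 5 := ⟨Fintype.card V - 5, by omega⟩
  have hk5' : Fintype.card {v : V // v ≠ z} = k5 + 4 := by omega
  obtain ⟨T, hTdef⟩ : ∃ T, ∑ a : {v : V // v ≠ z}, (if D.Adj a.1 z then deg (del D z) a else 0) = T := ⟨_, rfl⟩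
  rw [hTdef] at hsq hT
  obtain ⟨S', hS'def⟩ : ∃ S', ∑ a : {v : V // v ≠ z}, deg (del D z) a * deg (del D z) a = S' := ⟨_, rfl⟩
  rw [hS'def] at hsq
  obtain ⟨m', hm'def⟩ : ∃ m', (del D z).edgeFinset.card = m' := ⟨_, rfl⟩
  rw [hm'def] at hedges'
  -- the small cells are impossible: `4m' ≤ (k − 1)²`
  rcases Nat.lt_or_ge (k5 + 5 + r + d) 11 with hsmall | hlarge
  · exfalso
    have h4 := four_mul_card_edges_le_sq (del D z) hK' (by omega)
    rw [hm'def, hk5'] at h4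
    have hr2 : r ≤ 2 := by omega
    have hd2 : d ≤ 2 := by omega
    have hk52 : 2 ≤ k5 := by omega
    have hk55 : k5 ≤ 5 := by omega
    rw [hk5] at hm
    interval_cases k5 <;> interval_cases r <;> interval_cases d <;> omega
  · -- the cell `(k − 1, 4, r'')` of the row `a = 4`
    obtain ⟨r'', hr''⟩ : ∃ r'', r'' + 11 = k5 + 5 + r + d := ⟨k5 + 5 + r + d - 11, by omega⟩
    have hcell := closed_form_stability (del D z) hK' 4 r'' (by norm_num) (by omega) (by omega)
    rw [hS'def, hm'def, hk5'] at hcell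
    have hQ : k5 + 4 - 1 - r'' = 9 - r - d := by omega
    rw [hQ] at hcell
    obtain ⟨Q, hQdef⟩ : ∃ Q, Q + r + d = 9 := ⟨9 - r - d, by omega⟩
    have hQ' : 9 - r - d = Q := by omega
    rw [hQ'] at hcell
    rw [hk5] at hT hm ⊢
    have e1 : k5 + 5 - 5 = k5 := by omega
    have e2 : k5 + 5 - 1 - r = k5 + 4 - r := by omega
    have e3 : k5 + 5 - 7 = k5 - 2 := by omega
    rw [e1] at hT
    rw [e2, e3, hsq, ← hedges']
    exact cross_arith r d k5 m' S' T Q r'' _ hz hlarge (by omega) hr'' hQdef hcell hT rfl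

/-- **THE ROW `a = 3` AT SECOND ORDER, EVERY VERTEX TYPE, BY STRONG INDUCTION ON `r`:** on `k` vertices with
`m + 9 + r = 3k` and `r + 7 ≤ k`, a `K₄⁻`-free graph is a spanning subgraph of some `K(A, Aᶜ)` with `|A| = 3`,
or `Σ_v d(v)² + r (k − 1 − r) + 2 (k − 7) + 2·[r = 0] ≤ m k`. -/
theorem three_row_second_order_aux (r : ℕ) :
    ∀ (W : Type u) [Fintype W] [DecidableEq W] (D : SimpleGraph W) [DecidableRel D.Adj], K4mFree D →
      r + 7 ≤ Fintype.card W → D.edgeFinset.card + 9 + r = 3 * Fintype.card W →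
      (∃ A : Finset W, A.card = 3 ∧ BipSub D A) ∨
        ∑ v, deg D v * deg D v + r * (Fintype.card W - 1 - r) + 2 * (Fintype.card W - 7) +
          (if r = 0 then 2 else 0) ≤ D.edgeFinset.card * Fintype.card W := by
  refine Nat.strong_induction_on r ?_
  intro r ih W _ _ D _ hK hk hm
  -- the max-degree cap `d ≤ k − 3`
  have hcap : ∀ v, deg D v + 3 ≤ Fintype.card W := fun v =>
    deg_add_le_card_of_dense D hK 3 (by norm_num) (by omega)
      (cap_arith 3 (Fintype.card W) D.edgeFinset.card r (by norm_num) (by omega) (by omega)) v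
  -- (A) a vertex at the cap
  by_cases hx : ∃ x, deg D x + 3 = Fintype.card W
  · obtain ⟨x, hx⟩ := hx
    rcases three_row_cap D hK r hk hm x hx with h | ⟨hr1, h⟩
    · exact Or.inl h
    · right
      rw [if_neg (by omega)]
      simpa using h
  push Not at hx
  have hcap' : ∀ v, deg D v + 4 ≤ Fintype.card W := fun v => by
    have h1 := hcap v
    have h2 := hx v
    omega
  -- (B) every degree `≥ 3`
  by_cases hdeg : ∀ z, 3 ≤ deg D z
  · right
    have h := three_row_convex D r (by omega) hm hcap' hdeg
    have : (if r = 0 then 2 else 0) ≤ 2 := by split_ifs <;> omega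
    omega
  push Not at hdeg
  obtain ⟨z, hz⟩ := hdeg
  -- (C) a vertex `z` of degree `≤ 2`
  rcases Nat.lt_or_ge (r + deg D z) 3 with hcross | hwithin
  · exact Or.inr (three_row_cross D hK r hk hm hcap' z (by omega))
  · -- within the row: `D − z` on the cell `(k − 1, 3, r + d − 3)`
    have hK' := k4mFree_del D hK z
    have hcard' := card_del z
    have hedges' := card_edges_del D z
    have hsq := sum_deg_sq_del D z
    obtain ⟨d, hd⟩ : ∃ d, deg D z = d := ⟨_, rfl⟩
    rw [hd] at hz hwithin hedges' hsq
    obtain ⟨r', hr'⟩ : ∃ r', r' + 3 = r + d := ⟨r + d - 3, by omega⟩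
    have hm' : (del D z).edgeFinset.card + 9 + r' = 3 * Fintype.card {v : W // v ≠ z} := by omega
    have hk' : r' + 7 ≤ Fintype.card {v : W // v ≠ z} := by omega
    obtain ⟨s, hs⟩ : ∃ s, Fintype.card W = r + 7 + s := ⟨Fintype.card W - (r + 7), by omega⟩
    have hr1 : 1 ≤ r := by omega
    rw [if_neg (by omega)]
    have e2 : Fintype.card W - 1 - r = s + 6 := by omega
    have e3 : Fintype.card W - 7 = r + s := by omega
    rw [e2, e3, hsq, ← hedges', hs]
    obtain ⟨T, hTdef⟩ : ∃ T, ∑ a : {v : W // v ≠ z}, (if D.Adj a.1 z then deg (del D z) a else 0) = T :=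
      ⟨_, rfl⟩
    obtain ⟨S', hS'def⟩ : ∃ S', ∑ a : {v : W // v ≠ z}, deg (del D z) a * deg (del D z) a = S' := ⟨_, rfl⟩
    obtain ⟨m', hm'def⟩ : ∃ m', (del D z).edgeFinset.card = m' := ⟨_, rfl⟩
    rw [hTdef, hS'def, hm'def]
    have hQ : Fintype.card {v : W // v ≠ z} - 1 - r' = 8 + s - d := by omega
    have hcardW' : Fintype.card {v : W // v ≠ z} = r + 6 + s := by omega
    obtain ⟨Q, hQdef⟩ : ∃ Q, Q + d = 8 + s := ⟨8 + s - d, by omega⟩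
    have hQ' : 8 + s - d = Q := by omega
    rcases ih r' (by omega) {v : W // v ≠ z} (del D z) hK' hk' hm' with ⟨A', hA'card, hA'⟩ | hgap
    · -- `D − z` is `3`-bipartite
      by_cases hall : ∀ a : {v : W // v ≠ z}, D.Adj a.1 z → a ∈ A'
      · obtain ⟨B, hBcard, hB⟩ := bipSub_lift D z A' hA' hall
        exact Or.inl ⟨B, by rw [hBcard, hA'card], hB⟩
      · push Not at hall
        obtain ⟨a₀, ha₀z, ha₀A⟩ := hall
        right
        have hd1 : 1 ≤ d := by
          rw [← hd]
          unfold deg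
          exact card_pos.mpr ⟨a₀.1, mem_filter.mpr ⟨mem_univ _, D.adj_symm ha₀z⟩⟩
        have hsmall : deg (del D z) a₀ ≤ 3 := by
          have := deg_le_card_of_bipSub (del D z) A' hA' a₀ ha₀A
          rw [hA'card] at this
          exact this
        have hT := sum_del_nbhd_le_of_small D z (Fintype.card W - 5) 3 (fun v => by have := hcap' v; omega)
          a₀ ha₀z hsmall (by omega)
        rw [hTdef, hd, hs] at hT
        have hcell := closed_form_stability (del D z) hK' 3 r' (by norm_num) (by omega) hm'
        rw [hS'def, hm'def, hQ, hQ', hcardW'] at hcell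
        have e4 : r + 7 + s - 5 = r + 2 + s := by omega
        rw [e4] at hT
        have hT' : T + (r + s) ≤ d * (r + 2 + s) + 1 := by omega
        exact within_arith_bip r s d m' S' T Q r' hd1 (by omega) hr' (by omega) hQdef hcell hT'
    · -- `D − z` is at least `2 (k − 8) + 2·[r' = 0]` below its closed form
      right
      have hT := sum_del_nbhd_le D z (Fintype.card W - 5) (fun v => by have := hcap' v; omega)
      rw [hTdef, hd, hs] at hT
      have e4 : r + 7 + s - 5 = r + 2 + s := by omega
      rw [e4] at hT
      rw [hS'def, hm'def, hQ, hQ', hcardW'] at hgap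
      obtain ⟨k7, hk7⟩ : ∃ k7, k7 + 1 = r + s := ⟨r + s - 1, by omega⟩
      have e6 : r + 6 + s - 7 = k7 := by omega
      rw [e6] at hgap
      exact within_arith_gap r s d m' S' T Q r' k7 (by omega) hr' (by omega) hQdef hk7 hgap hT

/-- **THE ROW `a = 3` OF THE STABILITY TABLE, THE NON-BIPARTITE HALF:** `K₄⁻`-free, `m + 9 + r = 3k`,
`r + 7 ≤ k` ⇒ `D` is a spanning subgraph of some `K(A, Aᶜ)` with `|A| = 3`, or
`Σ_v d(v)² + r (k − 1 − r) + 2 (k − 7) + 2·[r = 0] ≤ m k`. -/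
theorem three_row_second_order (D : SimpleGraph V) [DecidableRel D.Adj] (hK : K4mFree D) (r : ℕ)
    (hk : r + 7 ≤ Fintype.card V) (hm : D.edgeFinset.card + 9 + r = 3 * Fintype.card V) :
    (∃ A : Finset V, A.card = 3 ∧ BipSub D A) ∨
      ∑ v, deg D v * deg D v + r * (Fintype.card V - 1 - r) + 2 * (Fintype.card V - 7) +
        (if r = 0 then 2 else 0) ≤ D.edgeFinset.card * Fintype.card V :=
  three_row_second_order_aux r V D hK hk hm

/-- The same for `r ≥ 1` without the indicator: not `3`-bipartite ⇒ `2 (k − 7)` below. -/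
theorem three_row_second_order_pos (D : SimpleGraph V) [DecidableRel D.Adj] (hK : K4mFree D) (r : ℕ)
    (hr : 1 ≤ r) (hk : r + 7 ≤ Fintype.card V) (hm : D.edgeFinset.card + 9 + r = 3 * Fintype.card V)
    (hnb : ¬ ∃ A : Finset V, A.card = 3 ∧ BipSub D A) :
    ∑ v, deg D v * deg D v + r * (Fintype.card V - 1 - r) + 2 * (Fintype.card V - 7) ≤
      D.edgeFinset.card * Fintype.card V := by
  rcases three_row_second_order D hK r hk hm with h | h
  · exact absurd h hnb
  · rw [if_neg (by omega)] at h
    simpa using h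

/-- The diagonal `r = 0`: not `3`-bipartite ⇒ `2 (k − 6)` below `m k`. -/
theorem three_row_second_order_zero (D : SimpleGraph V) [DecidableRel D.Adj] (hK : K4mFree D)
    (hk : 7 ≤ Fintype.card V) (hm : D.edgeFinset.card + 9 = 3 * Fintype.card V)
    (hnb : ¬ ∃ A : Finset V, A.card = 3 ∧ BipSub D A) :
    ∑ v, deg D v * deg D v + 2 * (Fintype.card V - 6) ≤ D.edgeFinset.card * Fintype.card V := by
  rcases three_row_second_order D hK 0 (by omega) (by omega) with h | h
  · exact absurd h hnb
  · simp only [if_true, zero_mul, add_zero] at h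
    omega

end C047

end TriangleCap

end PercRepro
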